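import Mathlib
import Summits.ValiantsHypothesis.ValiantsHypothesis.Theses.BarrierLever
import Summits.ValiantsHypothesis.ValiantsHypothesis.Theorems.BarrierLeverDefinableEquationsDefs
import Literature.Computability.AlgebraicComplexity.ArithCircuitProofs
import Literature.Computability.AlgebraicComplexity.DepthReductionProofs
import Summits.ValiantsHypothesis.ValiantsHypothesis.Theorems.BarrierLeverDefinableEquationsBalancedStrengthThin
import HarnessLib

/-!
# Crux `BarrierLever.DefinableEquations` (stmt-8745) ⟺ `SingleSizeEquations` (stmt-8749) —
# the STRENGTH DOOR: small circuits have polynomially bounded BALANCED STRENGTH, the class of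
# bounded balanced strength is thin, and explicit equations for it settle the crux rung by rung

Route `BarrierLever`, support item `SingleSizeEquations` (stmt-ValiantsHypothesis-8749; equivalent
to the crux `DefinableEquations`, stmt-8745, by the tree's
`definableEquations_iff_singleSizeEquations`).  Cell valiant-natproofs, seat val-np-p5 (gen 21).
Honest framing: `VP ≠ VNP` is NOT proved and nothing here is progress on it; the crux stays OPEN at
its first open rung `b = 2` (Chatterjee–Tengse 2023, §1.3, open direction 2).  This file adds a
CIRCUIT-FREE sufficient target for every rung — a new axis of the cell's chart of the crux.

## The class (written inline; no definition is introduced)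

For `n, s : ℕ` let `BP(n, s)` ("balanced products") be the set of `f ∈ ℂ[x_1..x_n]` with
`deg f ≤ n` such that EVERY homogeneous component is a short sum of balanced products:
`hom_d f = Σ_{i < s} g_i · h_i` with `deg g_i, deg h_i ≤ ⌊(2d+2)/3⌋` (all `d`).  Up to the harmless
slack of inhomogeneous factors this says: every component of `f` has DEGREE-RESTRICTED STRENGTH
`≤ s` in the sense of Ananyan–Hochster / Gesmundo–Ghosal–Ikenmeyer–Lysikov (both factors of degree
at most two thirds), i.e. lies on the `s`-th secant variety of the variety of `(e, d−e)`-reducible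
forms, `d/3 ≤ e ≤ 2d/3` (Catalisano–Geramita–Gimigliano–Harbourne–Migliore–Nagel–Shin).

## Results

* §1–§3 `exists_balanced_of_complexity_le` — **small circuits have polynomially bounded balanced
  strength**: if `L(f) ≤ s` (the tree's fan-in-two `complexity`) then for every `d` the component
  `hom_d f` is a sum of at most `4 s (d+1)² + 1` products `g · h` with `deg g, deg h ≤ ⌊(2d+2)/3⌋`.
  Proof: the Valiant–Skyum–Berkowitz–Rackoff frontier identity `[ν] = Σ_{μ ∈ F_m} [ν : μ] · [μ]`
  of the tree's `GateQuotients.lean` (Tavenas 2015 §5, `HomCircuit.val_eq_sum_frontier`) on the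
  homogenisation `SLP.homogenize` of an optimal circuit, at the threshold `m = ⌊2d/3⌋`: a frontier
  gate `μ = a × b` has `deg a, deg b ≤ m < deg μ`, so `[μ] = [light] · [heavy]` with
  `m/2 < deg heavy ≤ m`, and `g = [ν : μ]·[light]`, `h = [heavy]` are balanced
  (`exists_frontier_factors`); `#F_m ≤ 4 s (d+1)²` (`SLP.card_node_le`).
* §4 `smallCircuits_subset_balanced` — `SmallCircuits ℂ n b ⊆ BP(n, 4n^b(n+1)²+1)`; and THE DOOR
  `singleSize_at_of_balanced_equations` / `singleSizeEquations_of_balanced_equations`: level-`a`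
  Boolean-sum equations vanishing on `BP(n, 4n^b(n+1)²+1)` eventually in `n` give the inner
  statement of the crux at `b`; for all `b`, they give `BarrierLever.SingleSizeEquations` itself.
* Thinness of the class (non-explicit equations exist for `BP(n, n^c)`) is the route-independent
  sibling file `BarrierLeverDefinableEquationsBalancedStrengthThin.lean`; §7 (appended) draws the
  corollary `exists_equation_smallCircuits`: nonzero equations of every `SmallCircuits ℂ n b` exist
  eventually in `n`, without elimination theory.

## What this is, and what it is NOT

A DOOR (sufficient condition) and its non-vacuity, not a wall and not a verdict.  The door asks
for MORE than the crux (an equation of the bigger, circuit-free class `BP(n, poly(n))`, of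
dimension `≈ 2^{1.62 n} ≪ C(2n,n)`); in print, equations for bounded (degree-restricted or plain)
strength `r` are known only in the range `r ≤ (number of variables)/2` — from the singular locus
(`codim Sing(f) ≤ 2r`, Ananyan–Hochster; Ballico–Bik–Oneto–Ventura; GGIL 2022 Prop.) and from
Ruppert-type determinantal syzygy equations (2025, arXiv:2509.12322 §4, `n ≥ 2r`) — while the door
needs `r = 4n^b(n+1)²+1 ≥ n³` in `n` variables: explicit equations for `σ_r` of the varieties of
reducible forms in that range are an open problem of classical algebraic geometry ("determining
complete sets of defining equations for secant varieties, and for these varieties in particular,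
is considered a hard problem", ibid. §1).  No explicit equation is produced here; 8745/8749 stay
OPEN at `b = 2`; nothing is claimed about crux 14610 (`SuccinctHittingSetsForVP`) or `VP ≠ VNP`.

## References

* L. G. Valiant, S. Skyum, S. Berkowitz, C. Rackoff, *Fast parallel computation of polynomials
  using few processors*, SIAM J. Comput. 12 (1983) — gate quotients / frontier identity (tree:
  `Literature/Computability/AlgebraicComplexity/GateQuotients.lean`, Tavenas 2015 §5 form).
* S. Tavenas, *Improved bounds for reduction to depth 4 and depth 3*, Inform. Comput. 240 (2015),
  §4–§5 (homogenisation, `[α] = Σ_γ [α:γ][γ]`).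
* T. Ananyan, M. Hochster, *Small subalgebras of polynomial rings and Stillman's conjecture*,
  J. AMS 33 (2020) — strength.  F. Gesmundo, P. Ghosal, C. Ikenmeyer, V. Lysikov,
  *Degree-restricted strength decompositions and algebraic branching programs*, FSTTCS 2022
  (arXiv:2205.02149) — degree-restricted strength vs ABP width.  M. V. Catalisano et al., *Secant
  varieties of the varieties of reducible hypersurfaces in `P^n`*, J. Algebra 528 (2019)
  (arXiv:1502.00167).  E. Ballico, A. Bik, A. Oneto, E. Ventura, *The set of forms with bounded
  strength is not closed*, C. R. Math. 360 (2022); *Strength and slice rank of forms are generically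
  equal*, Israel J. Math. 254 (2023).  *Polynomials of small slice rank and strength* (2025),
  arXiv:2509.12322, §1, §2 Prop. 3, §4.
* M. A. Forbes, A. Shpilka, B. L. Volk, *Succinct hitting sets and barriers to proving lower bounds
  for algebraic circuits*, Theory Comput. 14 (2018), Def. 1 (the frame `SmallCircuits`,
  `degLEMonomials`, `coeffVector`).  P. Chatterjee, A. Tengse, arXiv:2309.07612 (2023), §1.3.
-/

set_option linter.dupNamespace false

noncomputable section

namespace Summit.ValiantsHypothesis.ValiantsHypothesis.Theorems.BarrierLeverDefinableEquations

open MvPolynomial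
open Literature.Computability.AlgebraicComplexity Literature.Barriers.ValiantsHypothesis
open Literature.Computability.AlgebraicComplexity.DepthReduction
open scoped BigOperators

namespace BalancedStrength

/-! ## §1 The frontier identity, read as a balanced two-factor decomposition -/

section Frontier

variable {k : Type*} [CommSemiring k] {σ : Type*} {ι : Type*} [Fintype ι] [DecidableEq ι]

/-- **Balanced two-factor form of the VSBR frontier identity.** For a node `ν` of a homogeneous
circuit certificate and `1 ≤ m < deg ν`, the value of `ν` is `Σ_{μ ∈ F_m} g_μ · h_μ` where
`h_μ` is the value of the heavier child of the frontier gate `μ` (formal degree `e_μ` with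
`m < 2 e_μ`, `e_μ ≤ m`) and `g_μ = [ν : μ] · (lighter child)` has total degree `≤ deg ν - e_μ`.
[cite: ValiantSkyumBerkowitzRackoff1983, frontier identity; Tavenas2015, §5] -/
theorem exists_frontier_factors (H : HomCircuit k σ ι) {m : ℕ} (hm : 1 ≤ m) {ν : ι}
    (hν : m < H.deg ν) :
    ∃ (e : ι → ℕ) (g h : ι → MvPolynomial σ k),
      (∀ μ ∈ H.frontier m, m < 2 * e μ ∧ e μ ≤ m ∧
        (g μ).totalDegree + e μ ≤ H.deg ν ∧ (h μ).totalDegree ≤ e μ) ∧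
      H.val ν = ∑ μ ∈ H.frontier m, g μ * h μ := by
  classical
  have hch : ∀ μ ∈ H.frontier m, ∃ ab : ι × ι,
      H.kind μ = .prod ab.1 ab.2 ∧ m < H.deg μ ∧ H.deg ab.1 ≤ m ∧ H.deg ab.2 ≤ m := by
    intro μ hμ
    obtain ⟨a, b, h1, h2, h3, h4⟩ := H.mem_frontier.1 hμ
    exact ⟨(a, b), h1, h2, h3, h4⟩
  choose! ab hab using hch
  refine ⟨fun μ => H.deg (H.heavy (ab μ).1 (ab μ).2),
    fun μ => H.quot ν μ * H.val (H.light (ab μ).1 (ab μ).2),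
    fun μ => H.val (H.heavy (ab μ).1 (ab μ).2), ?_, ?_⟩
  · intro μ hμ
    dsimp only
    obtain ⟨hkind, hdegμ, ha, hb⟩ := hab μ hμ
    have hsum := H.deg_prod_eq hkind
    have hlh := H.deg_light_le (ab μ).1 (ab μ).2
    have hheavy : H.deg (H.heavy (ab μ).1 (ab μ).2) ≤ m := by
      unfold HomCircuit.heavy
      split_ifs
      · exact hb
      · exact ha
    refine ⟨by omega, hheavy, ?_, H.totalDegree_val_le _⟩
    by_cases hle : H.deg μ ≤ H.deg ν
    · calc (H.quot ν μ * H.val (H.light (ab μ).1 (ab μ).2)).totalDegree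
            + H.deg (H.heavy (ab μ).1 (ab μ).2)
          ≤ ((H.quot ν μ).totalDegree + (H.val (H.light (ab μ).1 (ab μ).2)).totalDegree)
            + H.deg (H.heavy (ab μ).1 (ab μ).2) :=
            Nat.add_le_add_right (totalDegree_mul _ _) _
        _ ≤ ((H.deg ν - H.deg μ) + H.deg (H.light (ab μ).1 (ab μ).2))
            + H.deg (H.heavy (ab μ).1 (ab μ).2) :=
            Nat.add_le_add_right (Nat.add_le_add (H.totalDegree_quot_le _ _)
              (H.totalDegree_val_le _)) _
        _ = H.deg ν := by omega
    · have hq : H.quot ν μ = 0 := H.quot_eq_zero_of_deg_lt' (by omega)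
      simp only [hq, zero_mul, totalDegree_zero, zero_add]
      omega
  · rw [H.val_eq_sum_frontier hm hν]
    refine Finset.sum_congr rfl fun μ hμ => ?_
    rw [H.val_prod_eq (hab μ hμ).1, mul_assoc]

end Frontier

/-! ## §2 Re-indexing a finset-indexed sum by `Fin N` -/

section Reindex

variable {ι M : Type*} [AddCommMonoid M]

/-- Padding: a sum over a finset `T` with `#T ≤ N` is a sum over `Fin N` of the same terms and
zeros (`v i = some μ` reads term `μ`, `v i = none` reads `0`). [folklore] -/
theorem exists_pad (T : Finset ι) {N : ℕ} (hT : T.card ≤ N) :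
    ∃ v : Fin N → Option ι, (∀ i μ, v i = some μ → μ ∈ T) ∧
      ∀ F : ι → M, ∑ i, (v i).elim 0 F = ∑ μ ∈ T, F μ := by
  classical
  let e : T ≃ Fin T.card := T.equivFin
  refine ⟨fun i => if h : i.1 < T.card then some (e.symm ⟨i.1, h⟩).1 else none, ?_, ?_⟩
  · intro i μ hi
    by_cases h : i.1 < T.card
    · simp only [h, ↓reduceDIte, Option.some.injEq] at hi
      rw [← hi]
      exact (e.symm ⟨i.1, h⟩).2
    · simp [h] at hi
  · intro F
    set G : ℕ → M := fun j =>
      (if h : j < T.card then some (e.symm ⟨j, h⟩).1 else none).elim 0 F with hG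
    have step1 : ∑ i : Fin N, (if h : i.1 < T.card then some (e.symm ⟨i.1, h⟩).1 else none).elim
        (0 : M) F = ∑ j ∈ Finset.range N, G j :=
      Fin.sum_univ_eq_sum_range G N
    have step2 : ∑ j ∈ Finset.range N, G j = ∑ j ∈ Finset.range T.card, G j := by
      symm
      apply Finset.sum_subset (Finset.range_subset_range.2 hT)
      intro j _ hj
      simp only [Finset.mem_range] at hj
      simp [hG, hj]
    have step3 : ∑ j ∈ Finset.range T.card, G j = ∑ j : Fin T.card, F (e.symm j).1 := by
      rw [← Fin.sum_univ_eq_sum_range G T.card]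
      refine Finset.sum_congr rfl fun j _ => ?_
      simp [hG, j.isLt]
    have step4 : ∑ j : Fin T.card, F (e.symm j).1 = ∑ μ : T, F μ.1 :=
      Fintype.sum_equiv e.symm _ _ fun _ => rfl
    rw [step1, step2, step3, step4, Finset.sum_coe_sort]

end Reindex

/-! ## §3 Small circuits have polynomially bounded balanced strength -/

section Strength

variable {k : Type*} [CommSemiring k] {σ : Type*}

/-- Trivial decomposition: if the degree-`d` component of `f` itself has total degree
`≤ ⌊(2d+2)/3⌋` (e.g. `d ≤ 1`, or the component vanishes) then it is ONE balanced product
(times `1`), padded with zeros. [folklore] -/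
theorem exists_balanced_of_totalDegree_le {d s : ℕ} (hs : 1 ≤ s) (f : MvPolynomial σ k)
    (hf : (homogeneousComponent d f).totalDegree ≤ (2 * d + 2) / 3) :
    ∃ g h : Fin s → MvPolynomial σ k,
      (∀ i, (g i).totalDegree ≤ (2 * d + 2) / 3 ∧ (h i).totalDegree ≤ (2 * d + 2) / 3) ∧
      homogeneousComponent d f = ∑ i, g i * h i := by
  classical
  obtain ⟨s, rfl⟩ : ∃ t, s = t + 1 := ⟨s - 1, by omega⟩
  refine ⟨fun i => if i = 0 then homogeneousComponent d f else 0,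
    fun i => if i = 0 then 1 else 0, ?_, ?_⟩
  · intro i
    by_cases hi : i = 0 <;> simp [hi, hf]
  · rw [Fin.sum_univ_succ]
    simp

/-- **Small circuits have polynomially bounded balanced strength** (the VSBR frontier at
`m = ⌊2d/3⌋` of the homogenisation of an optimal circuit): if `L(f) ≤ s` then for every `d`
the degree-`d` homogeneous component of `f` is a sum of at most `4 s (d+1)² + 1` products
`g · h` of polynomials of total degree `≤ ⌊(2d+2)/3⌋` each (indexed by `Fin N` for any
`N ≥ 4 s (d+1)² + 1`, padding with zeros).
[cite: ValiantSkyumBerkowitzRackoff1983, frontier identity; Tavenas2015, §4–§5; Burgisser2000, Def. 2.1] -/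
theorem exists_balanced_of_complexity_le {s d N : ℕ} (f : MvPolynomial σ k)
    (hf : complexity f ≤ s) (hN : 4 * s * (d + 1) ^ 2 + 1 ≤ N) :
    ∃ g h : Fin N → MvPolynomial σ k,
      (∀ i, (g i).totalDegree ≤ (2 * d + 2) / 3 ∧ (h i).totalDegree ≤ (2 * d + 2) / 3) ∧
      homogeneousComponent d f = ∑ i, g i * h i := by
  classical
  have hN1 : 1 ≤ N := by omega
  -- small degrees: the component itself is balanced
  by_cases hd : d ≤ 1
  · refine exists_balanced_of_totalDegree_le hN1 f ?_
    refine ((homogeneousComponent_isHomogeneous d f).totalDegree_le).trans ?_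
    omega
  -- an optimal circuit, read as a straight-line program
  obtain ⟨P, hP2, hPf, hPs⟩ := ArithCircuit.exists_computes_size_eq_complexity f
  obtain ⟨S, hSlen, hcases⟩ := exists_slp P hP2
  have hfev : P.eval = f := hPf
  rcases hcases with ⟨i, hi, hval⟩ | ⟨j, hj⟩ | ⟨c, hc⟩
  · -- the main case: `f` is the value of line `i`
    set m : ℕ := 2 * d / 3 with hm
    have hm1 : 1 ≤ m := by omega
    have hmd : m < d := by omega
    set H : HomCircuit k σ (S.Node d) := S.homogenize d with hH
    set ν : S.Node d := (⟨i, hi⟩, SLP.Tag.Q ⟨d, Nat.lt_succ_self d⟩) with hν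
    have hdegν : H.deg ν = d := by rw [hH, hν]; rfl
    have hvalν : H.val ν = homogeneousComponent d f := by
      rw [hH, hν, ← hfev, hval]; rfl
    obtain ⟨e, g, h, hgh, hsum⟩ :=
      exists_frontier_factors H hm1 (ν := ν) (by rw [hdegν]; exact hmd)
    -- pad to `Fin N`
    have hcard : (H.frontier m).card ≤ N := by
      calc (H.frontier m).card ≤ Fintype.card (S.Node d) := Finset.card_le_univ _
        _ ≤ 4 * S.len * (d + 1) ^ 2 := S.card_node_le d
        _ ≤ 4 * s * (d + 1) ^ 2 := by
            have : S.len ≤ s := by rw [hSlen, hPs]; exact hf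
            exact Nat.mul_le_mul_right _ (Nat.mul_le_mul_left _ this)
        _ ≤ N := by omega
    obtain ⟨v, hvT, hvsum⟩ := exists_pad (M := MvPolynomial σ k) (H.frontier m) hcard
    refine ⟨fun i => (v i).elim 0 g, fun i => (v i).elim 0 h, ?_, ?_⟩
    · intro i
      dsimp only
      rcases hvi : v i with _ | μ
      · simp
      · obtain ⟨h1, h2, h3, h4⟩ := hgh μ (hvT i μ hvi)
        rw [hdegν] at h3
        simp only [Option.elim_some]
        constructor <;> omega
    · rw [← hvalν, hsum, ← hvsum (fun μ => g μ * h μ)]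
      refine Finset.sum_congr rfl fun i _ => ?_
      dsimp only
      rcases v i with _ | μ <;> simp
  · -- `f` is a variable: the component has degree `< 2 ≤ d`, hence vanishes
    refine exists_balanced_of_totalDegree_le hN1 f ?_
    rw [homogeneousComponent_eq_zero]
    · simp
    · rw [← hfev, hj]
      exact (totalDegree_X_le j : (X j : MvPolynomial σ k).totalDegree ≤ 1).trans_lt (by omega)
  · -- `f` is a constant
    refine exists_balanced_of_totalDegree_le hN1 f ?_
    rw [homogeneousComponent_eq_zero]
    · simp
    · rw [← hfev, hc, totalDegree_C]
      omega

end Strength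


/-! ## §4 The balanced-product class and the door to the crux

The class `BP(n, s)` (written inline, no definition): polynomials `f` of degree `≤ n` in `n`
variables each of whose homogeneous components `hom_d f` is a sum of at most `s` products
`g · h` with `deg g, deg h ≤ ⌊(2d+2)/3⌋` ("balanced strength `≤ s`" up to the harmless slack of
inhomogeneous factors). -/

section Door

/-- **`SmallCircuits ℂ n b ⊆ BP(n, 4 n^b (n+1)² + 1)`**: every polynomial of degree `≤ n` and
circuit size `≤ n^b` has every homogeneous component of balanced strength `≤ 4 n^b (n+1)² + 1`
(and `≤ N` terms for any larger `N`). [cite: ValiantSkyumBerkowitzRackoff1983, frontier identity; Tavenas2015, §5] -/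
theorem smallCircuits_subset_balanced {n b N : ℕ} (hN : 4 * n ^ b * (n + 1) ^ 2 + 1 ≤ N) :
    SmallCircuits ℂ n b ⊆
      {f : MvPolynomial (Fin n) ℂ | f.totalDegree ≤ n ∧ ∀ d : ℕ,
        ∃ g h : Fin N → MvPolynomial (Fin n) ℂ,
          (∀ i, (g i).totalDegree ≤ (2 * d + 2) / 3 ∧ (h i).totalDegree ≤ (2 * d + 2) / 3) ∧
          homogeneousComponent d f = ∑ i, g i * h i} := by
  intro f hf
  obtain ⟨hdeg, hcx⟩ := hf
  refine ⟨hdeg, fun d => ?_⟩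
  by_cases hd : d ≤ n
  · refine exists_balanced_of_complexity_le f hcx (le_trans ?_ hN)
    have : (d + 1) ^ 2 ≤ (n + 1) ^ 2 := Nat.pow_le_pow_left (by omega) 2
    have := Nat.mul_le_mul_left (4 * n ^ b) this
    omega
  · refine exists_balanced_of_totalDegree_le (by omega) f ?_
    rw [homogeneousComponent_eq_zero _ _ (by omega)]
    simp

/-- **The strength door, rung by rung.** If for the size exponent `b` there are a level `a` and
a threshold `n₀` such that for all `n ≥ n₀` some level-`a` Boolean sum is a nonzero polynomial in
the `N = C(2n,n)` coefficient variables vanishing at `coeff(f)` for every `f ∈ BP(n, 4n^b(n+1)²+1)`,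
then the inner statement of `SingleSizeEquations` / `DefinableEquations` holds at `b`.
[cite: ForbesShpilkaVolk2018, Def. 1; ValiantSkyumBerkowitzRackoff1983, frontier identity] -/
theorem singleSize_at_of_balanced_equations (b : ℕ)
    (hE : ∃ a n₀ : ℕ, ∀ n ≥ n₀, ∃ q : ℕ, q ≤ (Nat.choose (2 * n) n) ^ a ∧
      ∃ H : MvPolynomial (↥(degLEMonomials n) ⊕ Fin q) ℂ,
        complexity H ≤ (Nat.choose (2 * n) n) ^ a ∧ H.totalDegree ≤ (Nat.choose (2 * n) n) ^ a ∧
        boolSum H ≠ 0 ∧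
        ∀ f ∈ {f : MvPolynomial (Fin n) ℂ | f.totalDegree ≤ n ∧ ∀ d : ℕ,
            ∃ g h : Fin (4 * n ^ b * (n + 1) ^ 2 + 1) → MvPolynomial (Fin n) ℂ,
              (∀ i, (g i).totalDegree ≤ (2 * d + 2) / 3 ∧ (h i).totalDegree ≤ (2 * d + 2) / 3) ∧
              homogeneousComponent d f = ∑ i, g i * h i},
          eval (coeffVector (degLEMonomials n) f) (boolSum H) = 0) :
    ∃ a n₀ : ℕ, ∀ n ≥ n₀, ∃ q : ℕ, q ≤ (Nat.choose (2 * n) n) ^ a ∧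
      ∃ H : MvPolynomial (↥(degLEMonomials n) ⊕ Fin q) ℂ,
        complexity H ≤ (Nat.choose (2 * n) n) ^ a ∧ H.totalDegree ≤ (Nat.choose (2 * n) n) ^ a ∧
        boolSum H ≠ 0 ∧
        ∀ f ∈ SmallCircuits ℂ n b, eval (coeffVector (degLEMonomials n) f) (boolSum H) = 0 := by
  obtain ⟨a, n₀, h⟩ := hE
  refine ⟨a, n₀, fun n hn => ?_⟩
  obtain ⟨q, hq, H, hc, hd, hne, hvan⟩ := h n hn
  exact ⟨q, hq, H, hc, hd, hne, fun f hf => hvan f (smallCircuits_subset_balanced le_rfl hf)⟩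

/-- **The strength door for the whole support item**: explicit (level-`a(b)` Boolean-sum)
equations for bounded balanced strength `4n^b(n+1)²+1`, for every `b`, give
`BarrierLever.SingleSizeEquations` (stmt-ValiantsHypothesis-8749), hence the crux
`DefinableEquations` (stmt-8745) by the tree's `definableEquations_of_singleSizeEquations`.
[cite: ForbesShpilkaVolk2018, Def. 1; ValiantSkyumBerkowitzRackoff1983, frontier identity] -/
theorem singleSizeEquations_of_balanced_equations
    (hE : ∀ b : ℕ, ∃ a n₀ : ℕ, ∀ n ≥ n₀, ∃ q : ℕ, q ≤ (Nat.choose (2 * n) n) ^ a ∧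
      ∃ H : MvPolynomial (↥(degLEMonomials n) ⊕ Fin q) ℂ,
        complexity H ≤ (Nat.choose (2 * n) n) ^ a ∧ H.totalDegree ≤ (Nat.choose (2 * n) n) ^ a ∧
        boolSum H ≠ 0 ∧
        ∀ f ∈ {f : MvPolynomial (Fin n) ℂ | f.totalDegree ≤ n ∧ ∀ d : ℕ,
            ∃ g h : Fin (4 * n ^ b * (n + 1) ^ 2 + 1) → MvPolynomial (Fin n) ℂ,
              (∀ i, (g i).totalDegree ≤ (2 * d + 2) / 3 ∧ (h i).totalDegree ≤ (2 * d + 2) / 3) ∧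
              homogeneousComponent d f = ∑ i, g i * h i},
          eval (coeffVector (degLEMonomials n) f) (boolSum H) = 0) :
    Summit.ValiantsHypothesis.ValiantsHypothesis.Theses.BarrierLever.SingleSizeEquations := by
  intro b
  exact singleSize_at_of_balanced_equations b (hE b)

end Door


/-! ## §7 (appended) Corollary of the sibling's thinness: equations of `SmallCircuits ℂ n b` exist -/
section Corollary

/-- **Corollary: nonzero (non-explicit) equations of `SmallCircuits ℂ n b` exist, eventually in
`n`, for every `b`** — without any elimination machinery: balanced strength `≤ 4n^b(n+1)²+1 ≤ n^{b+3}`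
(§4) and thinness (sibling `exists_equation_eventually`). The crux asks for EXPLICITNESS.
[cite: HeintzSchnorr1980, existence of equations by dimension count; ValiantSkyumBerkowitzRackoff1983, frontier identity] -/
theorem exists_equation_smallCircuits (b : ℕ) : ∃ n₀ : ℕ, ∀ n ≥ n₀,
    ∃ D : MvPolynomial (degLEMonomials n) ℂ, D ≠ 0 ∧
      ∀ f ∈ SmallCircuits ℂ n b, eval (coeffVector (degLEMonomials n) f) D = 0 := by
  obtain ⟨n₀, hn₀⟩ := exists_equation_eventually (b + 3)
  refine ⟨max n₀ 9, fun n hn => ?_⟩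
  have hn9 : 9 ≤ n := le_of_max_le_right hn
  have hs : 4 * n ^ b * (n + 1) ^ 2 + 1 ≤ n ^ (b + 3) := by
    have h1 : (n + 1) ^ 2 ≤ 2 * n ^ 2 := by nlinarith
    have h1' := Nat.mul_le_mul_left (4 * n ^ b) h1
    have h3 : 1 ≤ n ^ (b + 2) := Nat.one_le_pow _ _ (by omega)
    have h4 : 9 * n ^ (b + 2) ≤ n ^ (b + 3) := by
      rw [pow_succ, mul_comm]; exact Nat.mul_le_mul_left _ hn9
    have h5 : 4 * n ^ b * (2 * n ^ 2) = 8 * n ^ (b + 2) := by ring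
    omega
  obtain ⟨D, hD0, hD⟩ := hn₀ n (le_of_max_le_left hn) _ hs
  exact ⟨D, hD0, fun f hf => hD f (smallCircuits_subset_balanced le_rfl hf)⟩

end Corollary

end BalancedStrength

end Summit.ValiantsHypothesis.ValiantsHypothesis.Theorems.BarrierLeverDefinableEquations
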